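import Literature.Computability.AlgebraicComplexity.MumfordStabilityOfSmoothForms
import Literature.Computability.AlgebraicComplexity.FormDiscriminantHomogeneous
import Literature.Computability.AlgebraicComplexity.FormSingularLocusHeight
import HarnessLib

/-!
# Every nonsingular form of degree `≥ 3` is polystable (Mumford–Fogarty–Kirwan Prop. 4.2), modulo
# the height bound of the discriminant ideal

Topic `Literature/Computability/AlgebraicComplexity` (cell `val-lit`, row BI2017-A; sequel of
`MumfordStabilityOfSmoothForms.lean` (seat t09) and `FormDiscriminantExists.lean` /
`FormDiscriminantHomogeneous.lean` (seat p5)). Theorems only — no definition, no named fact.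

`MumfordStabilityOfSmoothForms.isPolystable_of_invariant_ne_zero` proves: a form `F` of degree
`D ≥ 3` with `q(F) ≠ 0` for some `SL`-invariant `q` vanishing on all singular forms is polystable; with
the Reynolds-separation invariant (`q(Σ xᵢ^D) = 1`) this gives polystability GENERICALLY
(`BI2017_prop_2_10_holds`). Taking for `q` the DISCRIMINANT `Δ` (zero set = exactly the singular forms)
gives the printed statement of GIT Prop. 4.2 — EVERY nonsingular form of degree `≥ 3` is polystable —
for which the tree so far has the discriminant modulo ONE input, the height bound
`height I_S ≤ 1` of the prime ideal of the singular locus (part II-A of the programme, filed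
separately). This file records the implication:

* `isPolystable_of_isNonsingularForm_of_ker_eq_span` — unconditional in terms of ANY generator `Δ` of
  `I_S`;
* `isPolystable_of_isNonsingularForm_of_height` — from `height I_S ≤ 1`;
* `isPolystable_of_isNonsingularForm` — UNCONDITIONAL (appended once the height bound
  `FormDiscriminant.height_ker_singFamily_le_one` landed, `FormSingularLocusHeight.lean`, seat p7),
  with the Euclidean reading `isClosed_image_slOrbit_of_isNonsingularForm`.

Honest framing: classical GIT bookkeeping for row BI2017-A; typed ≠ endorsed; nothing here bears on
`VP` versus `VNP`, which is NOT proved.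

## References

* D. Mumford, J. Fogarty, F. Kirwan, *Geometric Invariant Theory*, 3rd ed., Springer 1994, Chap. 4
  §2 Prop. 4.2 («a smooth hypersurface `F = 0` of degree `≥ 3` is a stable point»; held text
  `book:mumford1994-geometric-invariant-theory` p0086) [MumfordFogartyKirwan1994].
* [BurgisserIkenmeyer2017] P. Bürgisser, C. Ikenmeyer, J. Algebra 477 (2017), Prop. 2.10, Def. 2.7.
-/

noncomputable section

open MvPolynomial

namespace Literature.Computability.AlgebraicComplexity

open Literature.AlgebraicGeometry.Motives.SmoothHypersurface

section MumfordAll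

variable {n D : ℕ}

/-- **Every nonsingular form of degree `D ≥ 3` is polystable, given a generator of the ideal of the
singular locus**: if `I_S = (Δ)` then `Δ` is an `SL`-invariant vanishing exactly on the singular
forms (`FormDiscriminantExists`), so `Δ(F) ≠ 0` for nonsingular `F` and
`isPolystable_of_invariant_ne_zero` applies. [cite: MumfordFogartyKirwan1994, Chap. 4 §2 Prop. 4.2] -/
theorem isPolystable_of_isNonsingularForm_of_ker_eq_span {F : MvPolynomial (Fin (n + 2)) ℂ}
    (hFD : F.IsHomogeneous D) (hD : 3 ≤ D)
    {Δ : MvPolynomial (DegIdx (Fin (n + 2)) D) ℂ}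
    (hΔ : RingHom.ker (aeval (R := ℂ)
        (FormDiscriminant.singFamilyCoeff (n := n) (D := D))).toRingHom = Ideal.span {Δ})
    (hF : IsNonsingularForm ℂ F) : IsPolystable F := by
  have hD2 : 2 ≤ D := by omega
  refine isPolystable_of_invariant_ne_zero hFD hD
    (FormDiscriminant.isSLInvariantCoord_of_ker_singFamily_eq_span hD2 hΔ) ?_ ?_
  · intro h
    exact (FormDiscriminant.aeval_eq_zero_iff_not_isNonsingularForm_of_ker_eq_span hD2 hΔ hFD).1 h hF
  · intro G hG hsing
    exact (FormDiscriminant.aeval_eq_zero_iff_not_isNonsingularForm_of_ker_eq_span hD2 hΔ hG).2 hsing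

/-- **Every nonsingular form of degree `D ≥ 3` in `n + 2 ≥ 2` variables over `ℂ` is polystable
(GIT Prop. 4.2), modulo the height bound `height I_S ≤ 1`** of the prime ideal of the singular locus
(which makes `I_S` principal, `FormDiscriminantExists.exists_prime_ker_singFamily_eq_span`).
[cite: MumfordFogartyKirwan1994, Chap. 4 §2 Prop. 4.2] -/
theorem isPolystable_of_isNonsingularForm_of_height {F : MvPolynomial (Fin (n + 2)) ℂ}
    (hFD : F.IsHomogeneous D) (hD : 3 ≤ D)
    (hI : (RingHom.ker (aeval (R := ℂ)
        (FormDiscriminant.singFamilyCoeff (n := n) (D := D))).toRingHom).height ≤ 1)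
    (hF : IsNonsingularForm ℂ F) : IsPolystable F := by
  obtain ⟨Δ, -, hΔ⟩ := FormDiscriminant.exists_prime_ker_singFamily_eq_span (by omega : 2 ≤ D) hI
  exact isPolystable_of_isNonsingularForm_of_ker_eq_span hFD hD hΔ hF

end MumfordAll

/-! ### GIT Prop. 4.2 as printed: every nonsingular form of degree `≥ 3` is polystable -/

section MumfordPrinted

variable {n D : ℕ}

/-- **Mumford–Fogarty–Kirwan, GIT Prop. 4.2, as printed** («a smooth hypersurface `F = 0` of degree
`≥ 3` in `ℙ^{n+1}` is a stable point»; here: the `SL_{n+2}(ℂ)`-orbit of every NONSINGULAR form of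
degree `D ≥ 3` in `n + 2 ≥ 2` variables is closed, `IsPolystable F`) — UNCONDITIONAL: the height bound
`height I_S ≤ 1` of `isPolystable_of_isNonsingularForm_of_height` is the tree's
`FormDiscriminant.height_ker_singFamily_le_one` (seat p7, `FormSingularLocusHeight.lean`), so the
discriminant exists and `isPolystable_of_invariant_ne_zero` (seat t09) applies to every nonsingular
form. [cite: MumfordFogartyKirwan1994, Chap. 4 §2 Prop. 4.2] -/
theorem isPolystable_of_isNonsingularForm {F : MvPolynomial (Fin (n + 2)) ℂ}
    (hFD : F.IsHomogeneous D) (hD : 3 ≤ D) (hF : IsNonsingularForm ℂ F) : IsPolystable F :=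
  isPolystable_of_isNonsingularForm_of_height hFD hD
    (FormDiscriminant.height_ker_singFamily_le_one (by omega)) hF

/-- **GIT Prop. 4.2 as printed, Euclidean reading** (BI 2017 Def. 2.7 dictionary,
`isPolystable_iff_isClosed_image_slOrbit`): for a nonsingular form `F` of degree `D ≥ 3` the set of
degree-`D` coefficient vectors of its `SL_{n+2}(ℂ)`-orbit is closed. [cite: MumfordFogartyKirwan1994, Chap. 4 §2 Prop. 4.2]
[cite: BurgisserIkenmeyer2017, Def. 2.7] -/
theorem isClosed_image_slOrbit_of_isNonsingularForm {F : MvPolynomial (Fin (n + 2)) ℂ}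
    (hFD : F.IsHomogeneous D) (hD : 3 ≤ D) (hF : IsNonsingularForm ℂ F) :
    IsClosed ((fun g (d : {d : Fin (n + 2) →₀ ℕ // d.degree = D}) => coeffVec g d.1) '' slOrbit (Fin (n + 2)) ℂ F) :=
  (isPolystable_of_isNonsingularForm hFD hD hF).isClosed_image_slOrbit hFD

end MumfordPrinted

end Literature.Computability.AlgebraicComplexity


end
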